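import Mathlib
import Literature.Computability.AlgebraicComplexity.SchoenhageTau
import Literature.Computability.AlgebraicComplexity.BorderApolarityLimits
import Literature.Computability.AlgebraicComplexity.TensorApolarityForms

/-!
# Fat border apolarity for `⟨3,3,3⟩` — support file A: the general-position certificate by top
# coefficients, and three bookkeeping lemmas

Crux `stmt-MatrixMultiplication-4958` (`FidelityWitnesses.FidelityGapThreeSeventeen`), line
`symbolic-square-border-apolarity`, stub `stub_fatBorderApolarity` (helper file; general, reusable,
theorems only).

Elementary linear algebra over `K[ε]`, `L = K(ε)` and `K`, extending the tree's
`BorderApolarityLimits` / `TensorApolarityForms` technology: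

* `finrank_vanishingL_add_le_of_coeff`, `finrank_vanishingL_add_finrank_range_le` — **the
  general-position certificate by TOP coefficients**: constant test vectors whose images under a family
  of `K[ε]`-valued functionals have `K`-independent top `ε`-coefficients (row-dependent top degrees
  allowed, as needed for jets: values and first partials of a form at a perturbed point have different
  `ε`-degrees) are `L`-independent, so they bound the rank of the family from below
  (`dim_L ker + k ≤ #coordinates`); this replaces the tree's `det_ne_zero_of_degree_lt` when no explicit
  minor is at hand, only a rank hypothesis on the limit configuration;
* `natDegree_prod_le_and_coeff` — top coefficient of a product with prescribed degree bounds;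
* `isApproxDecomposition_add_X_pow_mul` — an order-`h` approximate decomposition survives an
  `ε^M`-perturbation of all THREE factors, `M > h` (the tree's `IsApproxDecomposition.perturb` moves two).

References: A. Conner, A. Harper, J. M. Landsberg, Forum Math. Pi 11 (2023) e17 = arXiv:1911.07981,
§2.3 ("we may choose the curves such that `codim I_{ijk} = r`").
-/

noncomputable section

namespace Summit.MatrixMultiplication.MatrixMultiplication.Theorems.SymbolicSquare.FatBorder

-- single-conjunct summit: the `Summit.<S>.<P>` prefix repeats `MatrixMultiplication` by design (D-0017)
set_option linter.dupNamespace false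

open scoped BigOperators Polynomial
open Polynomial Module
open Literature.Computability.AlgebraicComplexity
open Literature.Computability.AlgebraicComplexity.TensorApolarity

universe u

/-! ## The general-position certificate by top coefficients -/

section Rank

variable {K : Type u} [Field K] (L : Type u) [Field L] [Algebra K[X] L] [IsFractionRing K[X] L]
variable {N : ℕ} {n : Type} [Fintype n]

/-- **General position by top coefficients.** If `k` constant test vectors `G j` have images
`Q_j(ℓ) = ∑_s G_j(s) P_ℓ(s)` of degree `≤ N ℓ` whose top-coefficient vectors `(Q_j(ℓ)[ε^{N ℓ}])_ℓ` are
`K`-linearly independent, then the functionals have rank `≥ k`: `dim_L ker + k ≤ |n|`. [folklore] -/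
theorem finrank_vanishingL_add_le_of_coeff (P : Fin N → n → K[X]) {k : ℕ} (G : Fin k → n → K)
    (Nd : Fin N → ℕ) (hdeg : ∀ j ℓ, (∑ s, C (G j s) * P ℓ s).natDegree ≤ Nd ℓ)
    (hli : LinearIndependent K (fun j => fun ℓ => (∑ s, C (G j s) * P ℓ s).coeff (Nd ℓ))) :
    finrank L (vanishingL L P) + k ≤ Fintype.card n := by
  classical
  set Q : Fin k → Fin N → K[X] := fun j ℓ => ∑ s, C (G j s) * P ℓ s with hQ
  set uu : Fin k → (n → L) := fun j s => algebraMap K[X] L (C (G j s)) with huu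
  have hE : ∀ j ℓ, evalL L P (uu j) ℓ = algebraMap K[X] L (Q j ℓ) := by
    intro j ℓ
    simp [huu, hQ, map_sum, map_mul]
  -- `L`-independence of the images
  have hind : LinearIndependent L (fun j => evalL L P (uu j)) := by
    rw [Fintype.linearIndependent_iff]
    intro c hc
    obtain ⟨b, hb⟩ := IsLocalization.exist_integer_multiples (nonZeroDivisors K[X]) Finset.univ c
    choose F hF using fun j => hb j (Finset.mem_univ j)
    have hb0 : algebraMap K[X] L (b : K[X]) ≠ 0 :=
      IsFractionRing.to_map_ne_zero_of_mem_nonZeroDivisors b.2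
    have hrel : ∀ ℓ, ∑ j, F j * Q j ℓ = 0 := by
      intro ℓ
      apply IsFractionRing.injective K[X] L
      have hi := congr_fun hc ℓ
      rw [Finset.sum_apply, Pi.zero_apply] at hi
      rw [map_sum, map_zero]
      calc ∑ j, algebraMap K[X] L (F j * Q j ℓ)
          = ∑ j, algebraMap K[X] L (b : K[X]) * ((c j • evalL L P (uu j)) ℓ) := by
            refine Finset.sum_congr rfl fun j _ => ?_
            rw [map_mul, hF j, Pi.smul_apply, smul_eq_mul, hE, Algebra.smul_def, mul_assoc]
        _ = 0 := by rw [← Finset.mul_sum, hi, mul_zero]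
    suffices hF0 : ∀ j, F j = 0 by
      intro j
      have hj := hF j
      rw [hF0 j, map_zero, Algebra.smul_def] at hj
      exact (mul_eq_zero.1 hj.symm).resolve_left hb0
    by_contra hne
    push Not at hne
    obtain ⟨j₀, hj₀⟩ := hne
    obtain ⟨j₁, hj₁, hmax⟩ := Finset.exists_max_image (Finset.univ.filter fun j => F j ≠ 0)
      (fun j => (F j).natDegree) ⟨j₀, by simpa using hj₀⟩
    rw [Finset.mem_filter] at hj₁
    set d := (F j₁).natDegree with hd
    have hle : ∀ j, (F j).natDegree ≤ d := by
      intro j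
      by_cases h0 : F j = 0
      · rw [h0, natDegree_zero]; exact Nat.zero_le _
      · exact hmax j (by simpa using h0)
    have hK : ∑ j, (F j).coeff d • (fun ℓ => (Q j ℓ).coeff (Nd ℓ)) = 0 := by
      funext ℓ
      rw [Finset.sum_apply, Pi.zero_apply]
      have := congrArg (fun p : K[X] => p.coeff (d + Nd ℓ)) (hrel ℓ)
      simp only [finsetSum_coeff, coeff_zero] at this
      rw [← this]
      refine Finset.sum_congr rfl fun j _ => ?_
      rw [Pi.smul_apply, smul_eq_mul, coeff_mul_add_eq_of_natDegree_le (hle j) (hdeg j ℓ)]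
    have hcoeff := (Fintype.linearIndependent_iff.1 hli _ hK) j₁
    have : (F j₁).leadingCoeff = 0 := hcoeff
    exact hj₁.2 (leadingCoeff_eq_zero.1 this)
  -- rank–nullity
  set g : Fin k → LinearMap.range (evalL L P) :=
    fun j => ⟨evalL L P (uu j), LinearMap.mem_range_self _ _⟩ with hg
  have hg' : LinearIndependent L g :=
    LinearIndependent.of_comp (LinearMap.range (evalL L P)).subtype hind
  have hk : k ≤ finrank L (LinearMap.range (evalL L P)) := by
    simpa using hg'.fintype_card_le_finrank
  have h := LinearMap.finrank_range_add_finrank_ker (evalL L P)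
  have : finrank L (n → L) = Fintype.card n := by simp
  change finrank L (LinearMap.ker (evalL L P)) + k ≤ Fintype.card n
  omega

/-- **Rank form of the top-coefficient certificate.** If a `K`-linear "top symbol" `T` computes the top
coefficients, `(∑_s g_s P_ℓ(s))[ε^{N ℓ}] = T g ℓ` with degrees `≤ N ℓ`, then
`dim_L ker + rank T ≤ |n|`. [folklore] -/
theorem finrank_vanishingL_add_finrank_range_le (P : Fin N → n → K[X]) (T : (n → K) →ₗ[K] (Fin N → K))
    (Nd : Fin N → ℕ) (h : ∀ (g : n → K) (ℓ : Fin N), (∑ s, C (g s) * P ℓ s).natDegree ≤ Nd ℓ ∧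
      (∑ s, C (g s) * P ℓ s).coeff (Nd ℓ) = T g ℓ) :
    finrank L (vanishingL L P) + finrank K (LinearMap.range T) ≤ Fintype.card n := by
  classical
  let b := Module.finBasis K (LinearMap.range T)
  have hmem : ∀ j, ∃ g : n → K, T g = (b j : Fin N → K) := fun j => LinearMap.mem_range.1 (b j).2
  choose G hG using hmem
  refine finrank_vanishingL_add_le_of_coeff L P G Nd (fun j ℓ => (h (G j) ℓ).1) ?_
  have : (fun j => fun ℓ => (∑ s, C (G j s) * P ℓ s).coeff (Nd ℓ)) =
      (LinearMap.range T).subtype ∘ b := by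
    funext j
    funext ℓ
    rw [(h (G j) ℓ).2, hG j]
    rfl
  rw [this]
  exact b.linearIndependent.map' _ (Submodule.ker_subtype _)

end Rank

/-! ## Two polynomial bookkeeping lemmas -/

section PolyTools

variable {K : Type u} [Field K]

/-- Top coefficient of a product with prescribed degree bounds: if `deg f_i ≤ N_i` then
`deg ∏ f_i ≤ ∑ N_i` and `(∏ f_i)[ε^{∑ N_i}] = ∏ f_i[ε^{N_i}]`. [folklore] -/
theorem natDegree_prod_le_and_coeff {α : Type*} (s : Finset α) (f : α → K[X]) (N : α → ℕ)
    (h : ∀ i ∈ s, (f i).natDegree ≤ N i) :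
    (∏ i ∈ s, f i).natDegree ≤ ∑ i ∈ s, N i ∧
      (∏ i ∈ s, f i).coeff (∑ i ∈ s, N i) = ∏ i ∈ s, (f i).coeff (N i) := by
  classical
  induction s using Finset.induction_on with
  | empty => simp
  | insert a s ha ih =>
    rw [Finset.prod_insert ha, Finset.sum_insert ha, Finset.prod_insert ha]
    have h' := ih fun i hi => h i (Finset.mem_insert_of_mem hi)
    have ha' := h a (Finset.mem_insert_self a s)
    exact ⟨natDegree_mul_le_of_le ha' h'.1, by rw [coeff_mul_add_eq_of_natDegree_le ha' h'.1, h'.2]⟩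

/-- A perturbation of order `ε^M`, `M > h`, of ALL THREE factors of an order-`h` approximate
decomposition is again one (the tree's `IsApproxDecomposition.perturb` moves two factors).
[cite: ConnerHarperLandsberg2023, §2.3] -/
theorem isApproxDecomposition_add_X_pow_mul {ι κ μ : Type*} {h r : ℕ} {t : ι → κ → μ → K}
    {u : Fin r → ι → K[X]} {v : Fin r → κ → K[X]} {w : Fin r → μ → K[X]}
    (hd : IsApproxDecomposition h t u v w) {M : ℕ} (hM : h < M)
    (U : Fin r → ι → K[X]) (V : Fin r → κ → K[X]) (W : Fin r → μ → K[X]) :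
    IsApproxDecomposition h t (fun ρ a => u ρ a + X ^ M * U ρ a) (fun ρ b => v ρ b + X ^ M * V ρ b)
      (fun ρ c => w ρ c + X ^ M * W ρ c) := by
  intro a b c j hj
  have key : ∀ ρ, (u ρ a + X ^ M * U ρ a) * (v ρ b + X ^ M * V ρ b) * (w ρ c + X ^ M * W ρ c) =
      u ρ a * v ρ b * w ρ c + X ^ M * (U ρ a * (v ρ b + X ^ M * V ρ b) * (w ρ c + X ^ M * W ρ c) +
        u ρ a * (V ρ b * (w ρ c + X ^ M * W ρ c) + v ρ b * W ρ c)) := by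
    intro ρ; ring
  have hlt : ¬ M ≤ j := by omega
  simp only [key, Finset.sum_add_distrib, ← Finset.mul_sum, coeff_add, coeff_X_pow_mul', if_neg hlt,
    add_zero]
  exact hd a b c j hj

/-- **Registered sub-goal `stub_fatBorderApolarity_perturb` of `stub_fatBorderApolarity`** (closed form of
`isApproxDecomposition_add_X_pow_mul` over `ℂ`): an order-`h` approximate decomposition survives an
`ε^M`-perturbation of all three factors, `M > h`. [cite: ConnerHarperLandsberg2023, §2.3] -/
theorem stub_fatBorderApolarity_perturb :
    ∀ (ι κ μ : Type) (h r M : ℕ) (t : ι → κ → μ → ℂ) (u U : Fin r → ι → Polynomial ℂ)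
      (v V : Fin r → κ → Polynomial ℂ) (w W : Fin r → μ → Polynomial ℂ),
      IsApproxDecomposition h t u v w → h < M →
        IsApproxDecomposition h t (fun ρ a => u ρ a + Polynomial.X ^ M * U ρ a)
          (fun ρ b => v ρ b + Polynomial.X ^ M * V ρ b) (fun ρ c => w ρ c + Polynomial.X ^ M * W ρ c) :=
  fun _ _ _ _ _ _ _ _ U _ V _ W hd hM => isApproxDecomposition_add_X_pow_mul hd hM U V W

end PolyTools

end Summit.MatrixMultiplication.MatrixMultiplication.Theorems.SymbolicSquare.FatBorder

end
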